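import Literature.NumberTheory.CubicFields.ShintaniDualDensity
import Literature.NumberTheory.CubicFields.ShintaniZetaConvergence
import HarnessLib

/-!
# `δ̂₁(Φ_m)` is a genuine supremum: the dual partial densities are bounded (under Prop. 4.5)

Topic `Literature/NumberTheory/CubicFields`; API for `ShintaniDualDensity.dualDensity` (BTT Thm 3.1 (18),
`δ̂₁(Φ_m) := m⁴ sup_N N⁻¹ Σ_α Σ_{n<N} a^α(|Φ̂_m|, n)`), formalized with Mathlib's conditionally complete `⨆`.
Here we prove that the sequence under the supremum is bounded — each dual coefficient satisfies
`a^α(|Φ̂_m|, n) ≤ (max |Φ_m|) · h(αn)` (every orbit contributes `|Φ̂_m|/|Stab| ≤ max|Φ_m|`, by `|Φ̂_m| ≤ max |Φ_m|`)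
and `Σ_{n<N} h(±n) = O(N)` is Prop. 4.5 at `q = 1` (`btt_uniformity_sqDvd`) — so that `⨆` is the supremum:
`m⁴ · N⁻¹ Σ_α Σ_{n<N} a^α(|Φ̂_m|, n) ≤ δ̂₁(Φ_m)` for every `N` (`mul_dualPartialDensity_le_dualDensity`) and
`δ̂₁(Φ_m) ≤ 2 C_U m⁴ max|Φ_m|` (`dualDensity_le`). Everything here is proved.

## References

* M. Bhargava, T. Taniguchi, F. Thorne, *Improved error estimates for the Davenport–Heilbronn theorems*,
  Math. Ann. 389 (2024) = arXiv:2107.12819, Thm 3.1 (18), Prop. 4.5 [BhargavaTaniguchiThorne2023].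
-/

noncomputable section

open Finset

namespace Literature.NumberTheory.CubicFields

variable {m : ℕ}

/-- **`|Σ_{orbits of disc D} w/|Stab|| ≤ B · h(D)`** for a weight with `|w| ≤ B` and `D ≠ 0`. [folklore] -/
theorem norm_shintaniCoeffWith_le {w : BinaryCubic ℤ → ℂ} {B : ℝ} (hB : 0 ≤ B) (hw : ∀ f, ‖w f‖ ≤ B)
    {D : ℤ} (hD : D ≠ 0) : ‖shintaniCoeffWith w D‖ ≤ B * classNumber D := by
  haveI := finite_orbitsOfDisc hD
  haveI : Fintype (orbitsOfDisc D) := Fintype.ofFinite _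
  unfold shintaniCoeffWith
  rw [finsum_eq_sum_of_fintype]
  calc ‖∑ O : orbitsOfDisc D, w (orbitRep O) / (stabCard (orbitRep O) : ℂ)‖
      ≤ ∑ O : orbitsOfDisc D, ‖w (orbitRep O) / (stabCard (orbitRep O) : ℂ)‖ := norm_sum_le _ _
    _ ≤ ∑ _O : orbitsOfDisc D, B := by
        refine Finset.sum_le_sum fun O _ => ?_
        rw [norm_div, Complex.norm_natCast]
        rcases Nat.eq_zero_or_pos (stabCard (orbitRep O)) with h0 | hpos
        · rw [h0, Nat.cast_zero, div_zero]; exact hB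
        · rw [div_le_iff₀ (by exact_mod_cast hpos)]
          calc ‖w _‖ ≤ B := hw _
            _ = B * 1 := (mul_one B).symm
            _ ≤ B * (stabCard (orbitRep O) : ℝ) := by gcongr; exact_mod_cast hpos
    _ = B * classNumber D := by
        rw [Finset.sum_const, Finset.card_univ, nsmul_eq_mul, mul_comm, classNumber, Nat.card_eq_fintype_card]

/-- **`a^α(|Φ̂_m|, n) ≤ (max|Φ_m|) · h(αn)`** for `n ≥ 1`, `α = ±1`. [folklore] -/
theorem dualAbsCoeff_re_le [NeZero m] {Φ : BinaryCubic (ZMod m) → ℂ} {B : ℝ} (hB : 0 ≤ B) (hΦ : ∀ y, ‖Φ y‖ ≤ B)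
    {α : ℤ} (hα : α = 1 ∨ α = -1) {n : ℕ} (hn : n ≠ 0) :
    (dualAbsCoeff Φ α n).re ≤ B * classNumber (α * n) := by
  have hD : (α * n : ℤ) ≠ 0 := by rcases hα with rfl | rfl <;> simp [hn]
  calc (dualAbsCoeff Φ α n).re ≤ ‖dualAbsCoeff Φ α n‖ := Complex.re_le_norm _
    _ ≤ B * classNumber (α * n) := norm_shintaniCoeffWith_le hB (norm_dualWeight_le hB hΦ) hD

/-- The `N`-th dual partial density `N⁻¹ Σ_{α = ±1} Σ_{1 ≤ n < N} a^α(|Φ̂_m|, n)` (the quantity under the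
supremum in (18), without the factor `m⁴`). [cite: BhargavaTaniguchiThorne2023, Thm 3.1 (18)] -/
def dualPartialDensity (Φ : BinaryCubic (ZMod m) → ℂ) (N : ℕ) : ℝ :=
  (N : ℝ)⁻¹ * ∑ n ∈ Finset.Ico 1 N, ((dualAbsCoeff Φ 1 n).re + (dualAbsCoeff Φ (-1) n).re)

/-- `δ̂₁(Φ_m) = m⁴ ⨆_N dualPartialDensity Φ N` (definitional). [folklore] -/
theorem dualDensity_eq (Φ : BinaryCubic (ZMod m) → ℂ) :
    dualDensity Φ = (m : ℝ) ^ 4 * ⨆ N : ℕ, dualPartialDensity Φ N := rfl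

/-- **The dual partial densities are bounded** (under Prop. 4.5): `N⁻¹ Σ_α Σ_{n<N} a^α(|Φ̂_m|, n) ≤ 2 B C_U`
where `Σ_{D ∈ window} h(D) ≤ C_U X`. [folklore] -/
theorem dualPartialDensity_le [NeZero m] (hU : btt_uniformity_sqDvd) {Φ : BinaryCubic (ZMod m) → ℂ} {B : ℝ}
    (hB : 0 ≤ B) (hΦ : ∀ y, ‖Φ y‖ ≤ B) :
    ∃ M : ℝ, ∀ N : ℕ, dualPartialDensity Φ N ≤ M := by
  obtain ⟨C, hC⟩ := exists_sum_classNumber_le hU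
  refine ⟨2 * B * C, fun N => ?_⟩
  have hC0 : 0 ≤ C := by
    have h := hC 1 (Or.inl rfl) 1
    have h0 : 0 ≤ ∑ D ∈ discWindow 1 1, (classNumber D : ℝ) := Finset.sum_nonneg fun _ _ => Nat.cast_nonneg _
    simpa using h0.trans h
  rcases Nat.eq_zero_or_pos N with rfl | hN
  · simp only [dualPartialDensity, Nat.cast_zero, inv_zero, zero_mul]; positivity
  have hsum : ∀ {α : ℤ}, (α = 1 ∨ α = -1) →
      ∑ n ∈ Finset.Ico 1 N, (dualAbsCoeff Φ α n).re ≤ B * (C * N) := by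
    intro α hα
    calc ∑ n ∈ Finset.Ico 1 N, (dualAbsCoeff Φ α n).re
        ≤ ∑ n ∈ Finset.Ico 1 N, B * (classNumber (α * n) : ℝ) := Finset.sum_le_sum fun n hn =>
          dualAbsCoeff_re_le hB hΦ hα (by have := (Finset.mem_Ico.mp hn).1; omega)
      _ = B * ∑ n ∈ Finset.Icc 1 (N - 1), (classNumber (α * n) : ℝ) := by
          have hIco : Finset.Ico 1 N = Finset.Icc 1 (N - 1) := by
            ext n; simp only [Finset.mem_Ico, Finset.mem_Icc]; omega
          rw [← Finset.mul_sum, hIco]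
      _ = B * ∑ D ∈ discWindow α (N - 1 + 1), (classNumber D : ℝ) := by rw [sum_Icc_classNumber_eq hα]
      _ ≤ B * (C * N) := by
          refine mul_le_mul_of_nonneg_left ?_ hB
          have h := hC α hα (N - 1 + 1)
          rwa [Nat.sub_add_cancel hN] at h ⊢
  have hN0 : (0 : ℝ) < N := by exact_mod_cast hN
  unfold dualPartialDensity
  rw [Finset.sum_add_distrib]
  calc (N : ℝ)⁻¹ * (∑ n ∈ Finset.Ico 1 N, (dualAbsCoeff Φ 1 n).re + ∑ n ∈ Finset.Ico 1 N, (dualAbsCoeff Φ (-1) n).re)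
      ≤ (N : ℝ)⁻¹ * (B * (C * N) + B * (C * N)) :=
        mul_le_mul_of_nonneg_left (add_le_add (hsum (Or.inl rfl)) (hsum (Or.inr rfl))) (by positivity)
    _ = 2 * B * C := by field_simp; ring

/-- `BddAbove` form of the boundedness. [folklore] -/
theorem bddAbove_dualPartialDensity [NeZero m] (hU : btt_uniformity_sqDvd) {Φ : BinaryCubic (ZMod m) → ℂ} {B : ℝ}
    (hB : 0 ≤ B) (hΦ : ∀ y, ‖Φ y‖ ≤ B) : BddAbove (Set.range (dualPartialDensity Φ)) := by
  obtain ⟨M, hM⟩ := dualPartialDensity_le hU hB hΦ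
  exact ⟨M, by rintro _ ⟨N, rfl⟩; exact hM N⟩

/-- **`δ̂₁` dominates every dual partial density: `m⁴ · N⁻¹ Σ_α Σ_{n<N} a^α(|Φ̂_m|, n) ≤ δ̂₁(Φ_m)`** (the use
of `δ̂₁` as an upper bound for dual sums in the proof of Thm 3.1). [cite: BhargavaTaniguchiThorne2023, Thm 3.1 (18) (δ̂₁ as the supremum)] -/
theorem mul_dualPartialDensity_le_dualDensity [NeZero m] (hU : btt_uniformity_sqDvd)
    {Φ : BinaryCubic (ZMod m) → ℂ} {B : ℝ} (hB : 0 ≤ B) (hΦ : ∀ y, ‖Φ y‖ ≤ B) (N : ℕ) :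
    (m : ℝ) ^ 4 * dualPartialDensity Φ N ≤ dualDensity Φ := by
  rw [dualDensity_eq]
  exact mul_le_mul_of_nonneg_left (le_ciSup (bddAbove_dualPartialDensity hU hB hΦ) N) (by positivity)

/-- **`δ̂₁(Φ_m) ≤ 2 C_U B m⁴`** for `|Φ_m| ≤ B` (under Prop. 4.5): the dual density is finite. [folklore] -/
theorem dualDensity_le [NeZero m] (hU : btt_uniformity_sqDvd) {Φ : BinaryCubic (ZMod m) → ℂ} {B : ℝ}
    (hB : 0 ≤ B) (hΦ : ∀ y, ‖Φ y‖ ≤ B) :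
    ∃ M : ℝ, dualDensity Φ ≤ (m : ℝ) ^ 4 * M := by
  obtain ⟨M, hM⟩ := dualPartialDensity_le hU hB hΦ
  exact ⟨M, by rw [dualDensity_eq]; exact mul_le_mul_of_nonneg_left (ciSup_le hM) (by positivity)⟩

end Literature.NumberTheory.CubicFields

end
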